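import Literature.MathematicalPhysics.QuantumFieldTheory.Balaban1983to89.B1Eq324BenfattoKernelSect5ClassRows
import Literature.MathematicalPhysics.QuantumFieldTheory.Balaban1983to89.B1Eq324BenfattoKernelSect5Iteration
import Literature.MathematicalPhysics.QuantumFieldTheory.Balaban1983to89.B1Eq324BenfattoKernelSect5Termination
import Literature.MathematicalPhysics.QuantumFieldTheory.Balaban1983to89.B1Eq324BenfattoSect5PavementChain
import HarnessLib

/-!
# `Balaban1983to89.B1Eq324BenfattoKernelSect5PavementChain` — [BenfattoEtAl1978] §5 pp. 154, 159 «repeat the procedure … with a new pavement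
# displaced», «Collecting all the errors made in this process (4.7) is proven», FOR THE CLASS of [Balaban1985BackgroundPropagators] Sect. E p. 428:
# the LOWER PAVEMENT CHAIN — `n` displaced class pavement steps in drifting frames, down to the class Appendix A, PROVED

statement-level skeleton of published theorems with citation tags; proofs where landed; nothing here is a claim about the
Yang–Mills mass gap

WHY THIS MODULE (cell `pub-ymgap`, seat `dag-n08-d` gen 13, INTENT-59; node N08 [Balaban1985UV3]; the [BenfattoEtAl1978] source chain behind the
(α)-row `h324`; row S8a of `N08-PORT-MAP-STRUCTURAL-SIDE.md`).  The concrete (4.7)-chain `…Sect5PavementChain.lowerPavementChain` iterates print's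
pavement step in DRIFTING FRAMES: a displaced pavement for the datum is the standard pavement for the translated datum, and `P̂₀` is translation
invariant.  A class kernel `K` (the covariance `A⁻¹` of a symmetric coercive finite-range-decaying precision `A` on a finite `Λ`, extended by `0`) is NOT
translation invariant — but the CLASS is shift-closed with the SAME constants (`…KernelSect5Iteration`, p611488): translating the datum by `τ` turns
`μ_{K(·+σ,·+σ)}` into `μ_{K(·+σ−τ,·+σ−τ)}`, the class kernel of the member `(Λ − (σ−τ), A(·+σ−τ,·+σ−τ))`, whose coercivity `γ_A`, Euclidean
Combes–Thomas row `J_c` (rate `θ`) and growth rows `V`, `M` are those of `(Λ, A)` (§1).  So the one full class step with its analytic rows discharged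
from the constants (`…KernelSect5ClassRows.pavementStep_of_classRows`, p615568) applies in every frame with the SAME closed-form price, and the steps
chain by `…Sect5Termination.exp_sum_mul_le_of_steps` exactly as in the concrete module, whose measure-free bookkeeping (`chain_invariants`,
`mem_chain_iff`, `chain_eq_empty_of_sep`) is imported, not restated.  The terminal small-field volume is seat n08-w5's class Appendix A
(`…KernelSect5Termination.integral_cutoffBoltzmann_empty_ge_of_kernel_translate`, p612013) — no socket is left.

WHAT IS PROVED (standard axioms; no `sorry`; no definition).
* §1 frames for the class: `l2_translate`; `submatrix_translate_row_le` (any translation-invariant two-point weight transports an absolute row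
  bound of `A` to the shifted precision — the ℓ² rows `J_c`, `M`), `translate_row_le` (the matrix-free row `V`); `integral_cutoffBoltzmann_frame`
  (`∫Π_Δχ̂^I_b e^{H^A_J} dμ_{G(·+τ,·+τ)} = ∫Π_Δχ̂^{I+τ}_b e^{H^{A(·−τ)}_{J+τ}} dμ_G`, the class form of `…Sect5PavementChain.integral_cutoffBoltzmann_frame`).
* §2 ★★ `pavementStep_of_classRows_frame` — ONE DISPLACED CLASS STEP: `pavementStep_of_classRows` for the member in frame `σ` applied to the datum
  translated by `τ`, read back under `μ_{K(·+σ+τ,·+σ+τ)}`; displayed: the frame-0 class constants and guard, the pavement of `B` inside `Λ − σ`, the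
  definitional part-kernel row, the per-box LOWER bounds in part-field currency; the labelling and the far kernel are constructed inside.
* §3 ★★★ `lowerPavementChain` — `n` displaced class steps along the recursion `J_{k+1} = (J_k + τ_k) ∩ Γ̄₁(B_k)`, `I_{k+1} = I_k + τ_k`,
  `A_{k+1} = (A_k(·−τ_k))|_{Γ̄₁(B_k)}`, `b_{k+1} = γb_k`, `σ_{k+1} = σ_k − τ_k` (`σ_0 = 0`):
  `exp(Σ_{k<n}(−err₅₁₁(k) − err₅₃₄(k) − 2P_k + Σ_{□∈B_k}ℓ_k(□)))·∫Π_Δχ̂^{I_n}_{b_n}e^{H^{A_n}_{J_n}}dμ_{K(·+σ_n,·+σ_n)} ≤ ∫Π_Δχ̂^{I_0}_{b_0}e^{H^{A_0}_{J_0}}dμ_K`,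
  `P_k = ρ_k + T_k/2` in closed form from `(γ_A, θ, J_c, V, M)`.
* §4 ★★ `lowerPavementChain_appendixA` — `d + 1` steps with separated displacements end in the free case (`chain_eq_empty_of_sep`) and the class
  Appendix A closes the chain with the explicit terminal constants `(k₁, k₂) = (4·8^d, γ_A/2)` at `b_{d+1}² ≥ 4/γ_A`.
* §5 (v1.1) `exists_stoppingIndex` (the first empty index `n ≤ d + 1` along separated displacements; measure-free); ★★
  `lowerPavementChain_appendixA_of_eq_empty` — the driver AT THE STOPPING INDEX: `n` steps, `J_n = ∅` in place of the separation of the displacements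
  (no price is paid on an empty pavement), terminal cut-off `b_n > 0`, `b_n² ≥ 4/γ_A`.
HONEST SCOPE.  The lower ((4.7)-side) chain for the class only; the per-box LOWER bounds `hbox` stay displayed at every step (the cluster side's
`…KernelSect5PerBoxAtPavement` discharges them per step); the upper ((4.6)-side) chain under the conditional law and the `∃`-knit are NOT in this file;
the class, the temperature-zero substitute for (5.13) and the bounded-fluctuation device are OURS, not print's; nothing of [Balaban1985UV3] /
[Balaban1985UV2] is asserted; NO generalised Basic Lemma is stated here; the port is not commissioned; count-neutral for N08; nothing about d = 4, the
continuum, OS axioms, a mass gap or the Clay problem.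
-/

noncomputable section

open MeasureTheory ProbabilityTheory Finset Matrix
open scoped BigOperators Matrix

namespace Literature.MathematicalPhysics.QuantumFieldTheory.Balaban1983to89.B1Eq324BenfattoKernelSect5PavementChain

open Literature.MathematicalPhysics.QuantumFieldTheory
open Literature.MathematicalPhysics.QuantumFieldTheory.GaussianToolkit
open Literature.MathematicalPhysics.QuantumFieldTheory.Balaban1983to89.B1Eq324BenfattoLemma
open Literature.MathematicalPhysics.QuantumFieldTheory.Balaban1983to89.B1Eq324BenfattoKernelOfPrecision
open Literature.MathematicalPhysics.QuantumFieldTheory.Balaban1983to89.B1Eq324BenfattoKernelSect5Iteration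
open Literature.MathematicalPhysics.QuantumFieldTheory.Balaban1983to89.B1Eq324BenfattoKernelSect5ClassRows
open Literature.MathematicalPhysics.QuantumFieldTheory.Balaban1983to89.B1Eq324BenfattoKernelSect5Termination (kernel_self_le_inv
  integral_cutoffBoltzmann_empty_ge_of_kernel_translate)
open Literature.MathematicalPhysics.QuantumFieldTheory.Balaban1983to89.B1Eq324BenfattoSect5PavementChain (chain_invariants chain_eq_empty_of_sep
  coefSupportedIn_frame abs_shiftCoef_neg_le shiftCoef_shiftCoef_neg)
open Literature.MathematicalPhysics.QuantumFieldTheory.Balaban1983to89.B1Eq324BenfattoClassAppendixC (posDef_of_coercive)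
open Literature.MathematicalPhysics.QuantumFieldTheory.Balaban1983to89.B1Eq324BenfattoAppendixA (distToRegion_nonneg)
open Literature.MathematicalPhysics.QuantumFieldTheory.Balaban1983to89.B1Eq324BenfattoSect5Boxes
open Literature.MathematicalPhysics.QuantumFieldTheory.Balaban1983to89.B1Eq324BenfattoSect5Eq511 (s1Const)
open Literature.MathematicalPhysics.QuantumFieldTheory.Balaban1983to89.B1Eq324BenfattoSect5Eq524 (psi1p psi2)
open Literature.MathematicalPhysics.QuantumFieldTheory.Balaban1983to89.B1Eq324BenfattoSect5Eq534 (corridorsBar)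
open Literature.MathematicalPhysics.QuantumFieldTheory.Balaban1983to89.B1Eq324BenfattoSect5Iteration
open Literature.MathematicalPhysics.QuantumFieldTheory.Balaban1983to89.B1Eq324BenfattoSect5Termination (exp_sum_mul_le_of_steps)
open Literature.MathematicalPhysics.QuantumFieldTheory.Balaban1983to89.B1Eq324BenfattoSect5Eq515

variable {d : ℕ}

/-! ## §1  Frames for the class: the ℓ² rows and the (4.7)-integral under a translated kernel -/

section Frames

variable {Λ : Finset (B1Eq324BenfattoLemma.Site d)} {A : Matrix Λ Λ ℝ} (σ : B1Eq324BenfattoLemma.Site d)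

/-- The Euclidean site distance is translation invariant. [folklore] [cite: BenfattoEtAl1978, p.159 (class form)] -/
theorem l2_translate (x y σ : B1Eq324BenfattoLemma.Site d) :
    Real.sqrt (∑ j, ((((x + σ) j : ℝ) - ((y + σ) j : ℝ))) ^ 2) = Real.sqrt (∑ j, (((x j : ℝ) - (y j : ℝ))) ^ 2) := by
  congr 1
  refine Finset.sum_congr rfl fun j _ => ?_
  simp only [Pi.add_apply, Int.cast_add]
  ring

/-- **Any translation-invariant two-point weight transports an absolute row bound to the shifted precision**: if `ψ(x+σ, y+σ) = ψ(x, y)` and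
`Σ_{e′}|A_{ee′}|ψ(e, e′) ≤ M` on `Λ`, the same holds for `A(·+σ,·+σ)` on `Λ − σ` (the sum is re-indexed along `j ↦ j + σ`); the ℓ² Combes–Thomas
row `ψ = cosh(θ|·−·|₂) − 1` and the growth row `ψ = 1 + |·−·|₂` are the instances used below. [folklore] [cite: BenfattoEtAl1978, p.159 (class form)] -/
theorem submatrix_translate_row_le {M : ℝ} (ψ : B1Eq324BenfattoLemma.Site d → B1Eq324BenfattoLemma.Site d → ℝ) (hψ : ∀ x y, ψ (x + σ) (y + σ) = ψ x y)
    (hM : ∀ e : Λ, ∑ e' : Λ, |A e e'| * ψ (e : B1Eq324BenfattoLemma.Site d) (e' : B1Eq324BenfattoLemma.Site d) ≤ M) :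
    ∀ e : ↥(Λ.image fun y => y - σ), ∑ e' : ↥(Λ.image fun y => y - σ),
      |A.submatrix (fun j : ↥(Λ.image fun y => y - σ) => (⟨(j : B1Eq324BenfattoLemma.Site d) + σ, (mem_image_sub_iff σ).mp j.2⟩ : Λ))
        (fun j : ↥(Λ.image fun y => y - σ) => (⟨(j : B1Eq324BenfattoLemma.Site d) + σ, (mem_image_sub_iff σ).mp j.2⟩ : Λ)) e e'| *
        ψ (e : B1Eq324BenfattoLemma.Site d) (e' : B1Eq324BenfattoLemma.Site d) ≤ M := by
  classical
  intro j
  let e : ↥(Λ.image fun y => y - σ) ≃ Λ :=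
    { toFun := fun j => ⟨(j : B1Eq324BenfattoLemma.Site d) + σ, (mem_image_sub_iff σ).mp j.2⟩
      invFun := fun k => ⟨(k : B1Eq324BenfattoLemma.Site d) - σ, Finset.mem_image.mpr ⟨k, k.2, rfl⟩⟩
      left_inv := fun j => Subtype.ext (add_sub_cancel_right _ _)
      right_inv := fun k => Subtype.ext (sub_add_cancel _ _) }
  have h := hM (e j)
  have hre : ∑ e' : Λ, |A (e j) e'| * ψ ((e j : Λ) : B1Eq324BenfattoLemma.Site d) (e' : B1Eq324BenfattoLemma.Site d) =
      ∑ j' : ↥(Λ.image fun y => y - σ), |A (e j) (e j')| * ψ ((e j : Λ) : B1Eq324BenfattoLemma.Site d) ((e j' : Λ) : B1Eq324BenfattoLemma.Site d) := by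
    rw [← e.sum_comp]
  rw [hre] at h
  refine le_trans (le_of_eq (Finset.sum_congr rfl fun j' _ => ?_)) h
  have hj : ((e j : Λ) : B1Eq324BenfattoLemma.Site d) = (j : B1Eq324BenfattoLemma.Site d) + σ := rfl
  have hj' : ((e j' : Λ) : B1Eq324BenfattoLemma.Site d) = (j' : B1Eq324BenfattoLemma.Site d) + σ := rfl
  rw [hj, hj', hψ]
  rfl

/-- **The matrix-free row transports too**: if `ψ(x+σ, y+σ) = ψ(x, y)` and `Σ_{e′∈Λ}ψ(e, e′) ≤ V` for `e ∈ Λ`, then `Σ_{e′∈Λ−σ}ψ(e, e′) ≤ V` for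
`e ∈ Λ − σ` (the growth row `ψ = e^{−θ|·−·|₂}(1 + |·−·|₂)` of J1 F5). [folklore] [cite: BenfattoEtAl1978, p.159 (class form)] -/
theorem translate_row_le {V : ℝ} (ψ : B1Eq324BenfattoLemma.Site d → B1Eq324BenfattoLemma.Site d → ℝ) (hψ : ∀ x y, ψ (x + σ) (y + σ) = ψ x y)
    (hV : ∀ e : Λ, ∑ e' : Λ, ψ (e : B1Eq324BenfattoLemma.Site d) (e' : B1Eq324BenfattoLemma.Site d) ≤ V) :
    ∀ e : ↥(Λ.image fun y => y - σ), ∑ e' : ↥(Λ.image fun y => y - σ), ψ (e : B1Eq324BenfattoLemma.Site d) (e' : B1Eq324BenfattoLemma.Site d) ≤ V := by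
  classical
  intro j
  let e : ↥(Λ.image fun y => y - σ) ≃ Λ :=
    { toFun := fun j => ⟨(j : B1Eq324BenfattoLemma.Site d) + σ, (mem_image_sub_iff σ).mp j.2⟩
      invFun := fun k => ⟨(k : B1Eq324BenfattoLemma.Site d) - σ, Finset.mem_image.mpr ⟨k, k.2, rfl⟩⟩
      left_inv := fun j => Subtype.ext (add_sub_cancel_right _ _)
      right_inv := fun k => Subtype.ext (sub_add_cancel _ _) }
  have h := hV (e j)
  have hre : ∑ e' : Λ, ψ ((e j : Λ) : B1Eq324BenfattoLemma.Site d) (e' : B1Eq324BenfattoLemma.Site d) =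
      ∑ j' : ↥(Λ.image fun y => y - σ), ψ ((e j : Λ) : B1Eq324BenfattoLemma.Site d) ((e j' : Λ) : B1Eq324BenfattoLemma.Site d) := by
    rw [← e.sum_comp]
  rw [hre] at h
  refine le_trans (le_of_eq (Finset.sum_congr rfl fun j' _ => ?_)) h
  have hj : ((e j : Λ) : B1Eq324BenfattoLemma.Site d) = (j : B1Eq324BenfattoLemma.Site d) + σ := rfl
  have hj' : ((e j' : Λ) : B1Eq324BenfattoLemma.Site d) = (j' : B1Eq324BenfattoLemma.Site d) + σ := rfl
  rw [hj, hj', hψ]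

variable {G : B1Eq324BenfattoLemma.Site d → B1Eq324BenfattoLemma.Site d → ℝ} {s D : ℕ} {κ : ℝ} {a : Coef d}

/-- **THE (4.7)-INTEGRAL IN A DRIFTING FRAME, FOR THE CLASS**: `∫Π_Δχ̂^I_b e^{H^A_J} dμ_{G(·+τ,·+τ)} = ∫Π_Δχ̂^{I+τ}_b e^{H^{A(·−τ)}_{J+τ}} dμ_G` for
every positive-semidefinite kernel `G` — a displaced pavement for the datum is the standard pavement for the translated datum, the Gaussian field
moving contravariantly (`…KernelSect5Iteration.integral_cutoffBoltzmann_translate` read in the assembler's direction; the free-field statement is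
`…Sect5PavementChain.integral_cutoffBoltzmann_frame`, where `μ_{G(·+τ,·+τ)} = μ_G`). [cite: BenfattoEtAl1978, §5 p.159 «a new pavement displaced» (class form; ours)] -/
theorem integral_cutoffBoltzmann_frame (hG : IsPosSemidefKernel G) (J I : Finset (B1Eq324BenfattoLemma.Site d)) (b : ℝ) (τ : B1Eq324BenfattoLemma.Site d) :
    ∫ z, cutoffBoltzmann (hamiltonian s D κ a J) I b z ∂gaussianFieldOfKernel (fun x y => G (x + τ) (y + τ)) =
      ∫ z, cutoffBoltzmann (hamiltonian s D κ (shiftCoef a (-τ)) (J.image fun x => x + τ)) (I.image fun x => x + τ) b z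
        ∂gaussianFieldOfKernel G := by
  rw [integral_cutoffBoltzmann_translate hG, shiftCoef_shiftCoef_neg]

end Frames

/-! ## §2  One displaced class pavement step, the analytic rows discharged from the frame-0 constants -/

section Step

variable {Λ : Finset (B1Eq324BenfattoLemma.Site d)} {A : Matrix Λ Λ ℝ}
  {K : B1Eq324BenfattoLemma.Site d → B1Eq324BenfattoLemma.Site d → ℝ}
  (hK : ∀ x y, K x y = if h : x ∈ Λ ∧ y ∈ Λ then (A⁻¹ : Matrix Λ Λ ℝ) ⟨x, h.1⟩ ⟨y, h.2⟩ else 0)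
  {s D : ℕ} {κ : ℝ} {L w v : ℕ} {γ Ac : ℝ}

include hK

/-- **ONE DISPLACED CLASS PAVEMENT STEP** — `…KernelSect5ClassRows.pavementStep_of_classRows` for the class member in frame `σ`
(`(Λ − σ, A(·+σ,·+σ))`, class kernel `K(·+σ,·+σ)`, `…KernelSect5Iteration.kernel_translate`) applied to the datum `(A(·−τ), J+τ, I+τ, b)`, read back
under the frame-`(τ+σ)` field by `integral_cutoffBoltzmann_frame`: for the frame-0 class constants — `A` symmetric `γ_A`-coercive with Euclidean
Combes–Thomas row `J_c < γ_A` (rate `θ > 0`), growth rows `V`, `M`, guard `J_c/(cosh θw − 1) < γ_A` (all frame invariant, §1) —, `A` supported in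
`J ⊆ I` with the global bound `|A| ≤ A_c`, print's pavement (`L ≥ 1`, `0 < w`, `v ≤ w`) of `B ⊇` the tesserae meeting `J + τ` with corridors and boxes
inside `Λ − σ`, the definitional part-kernel row, `0 ≤ γ ≤ 1 ≤ b`, and per-box LOWER bounds for the translated datum in part-field currency:
`exp(−err₅₁₁ − err₅₃₄ − 2(ρ + T/2) + Σ_{□∈B}ℓ_□)·∫Π_Δχ̂^{I+τ}_{γb}e^{H^{(A(·−τ))|Γ̄₁}_{(J+τ)∩Γ̄₁}}dμ_{K(·+σ,·+σ)} ≤ ∫Π_Δχ̂^{I}_{b}e^{H^A_J}dμ_{K(·+(τ+σ),·+(τ+σ))}` with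
`r_y = J_c/(cosh(θ·max(w, d(Δ_y, ∪B))) − 1)` over `y ∈ (Λ−σ) − Γ₁`, `r_max = J_c/(cosh θw − 1)`, `C_u = VMγ/(γ_A − J_c)`, `T = (1+C_u)²b²Σ_y r_y(1+d(I+τ,y))²`,
`ρ = Σ_y r_y/(γ_A − r_max)`; the labelling (`exists_labels`) and the far kernel are constructed inside.
[cite: BenfattoEtAl1978, §5 (5.9)–(5.15) p.155, (5.34)–(5.35) p.159, p.159 «a new pavement displaced»; Balaban1985BackgroundPropagators, (1.16)–(1.18) p.180 (class form; ours)] -/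
theorem pavementStep_of_classRows_frame
    (hAs : ∀ e e', A e e' = A e' e) {γA : ℝ} (hγA0 : 0 < γA)
    (hγA : ∀ x : Λ → ℝ, γA * ∑ e, x e ^ 2 ≤ ∑ e, ∑ e', A e e' * x e * x e')
    {θ Jc V M : ℝ} (hθ : 0 < θ)
    (hJc : ∀ e : Λ, ∑ e' : Λ, |A e e'| * (Real.cosh (θ * Real.sqrt (∑ j, ((((e : B1Eq324BenfattoLemma.Site d) j : ℝ) - ((e' : B1Eq324BenfattoLemma.Site d) j : ℝ))) ^ 2)) - 1) ≤ Jc)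
    (hJcγ : Jc < γA)
    (hV : ∀ e : Λ, ∑ e' : Λ, Real.exp (-(θ * Real.sqrt (∑ j, ((((e : B1Eq324BenfattoLemma.Site d) j : ℝ) - ((e' : B1Eq324BenfattoLemma.Site d) j : ℝ))) ^ 2))) *
      (1 + Real.sqrt (∑ j, ((((e : B1Eq324BenfattoLemma.Site d) j : ℝ) - ((e' : B1Eq324BenfattoLemma.Site d) j : ℝ))) ^ 2)) ≤ V)
    (hM : ∀ e : Λ, ∑ e' : Λ, |A e e'| * (1 + Real.sqrt (∑ j, ((((e : B1Eq324BenfattoLemma.Site d) j : ℝ) - ((e' : B1Eq324BenfattoLemma.Site d) j : ℝ))) ^ 2)) ≤ M)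
    (hguard : Jc / (Real.cosh (θ * w) - 1) < γA)
    (hκ : 0 < κ) {a : Coef d} {J I : Finset (B1Eq324BenfattoLemma.Site d)} (hJ : CoefSupportedIn a J) (hAc0 : 0 ≤ Ac)
    (hAc : ∀ (p : ℕ) (Δ : Fin p → B1Eq324BenfattoLemma.Site d) (n : Fin p → ℕ), |a p Δ n| ≤ Ac)
    (hJI : J ⊆ I) (hL : 0 < L) (hw : 0 < w) (hv : v ≤ w) (hγ0 : 0 ≤ γ) (hγ1 : γ ≤ 1) {b : ℝ} (hb : 1 ≤ b)
    (σ τ : B1Eq324BenfattoLemma.Site d) {B : Finset (B1Eq324BenfattoLemma.Site d)}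
    (hΓΛ : corridors L w B ⊆ Λ.image fun y => y - σ) (hBΛ : ∀ m ∈ B, box L m ⊆ Λ.image fun y => y - σ)
    (hB : (J.image fun x => x + τ).image (boxIndex L) ⊆ B)
    {Kb : B1Eq324BenfattoLemma.Site d → B1Eq324BenfattoLemma.Site d → B1Eq324BenfattoLemma.Site d → ℝ}
    (hKb : ∀ m (hm : m ∈ B) x y, Kb m x y = if h : x ∈ shrink L m w ∧ y ∈ shrink L m w then
      (((A.submatrix (fun j : ↥(Λ.image fun y => y - σ) => (⟨(j : B1Eq324BenfattoLemma.Site d) + σ, (mem_image_sub_iff σ).mp j.2⟩ : Λ))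
          (fun j : ↥(Λ.image fun y => y - σ) => (⟨(j : B1Eq324BenfattoLemma.Site d) + σ, (mem_image_sub_iff σ).mp j.2⟩ : Λ))).submatrix
          (fun j : ↥(shrink L m w) => (⟨j, hBΛ m hm (shrink_subset_box L m w j.2)⟩ : ↥(Λ.image fun y => y - σ)))
          (fun j : ↥(shrink L m w) => (⟨j, hBΛ m hm (shrink_subset_box L m w j.2)⟩ : ↥(Λ.image fun y => y - σ))))⁻¹ :
          Matrix ↥(shrink L m w) ↥(shrink L m w) ℝ) ⟨x, h.1⟩ ⟨y, h.2⟩ else 0)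
    (ℓ : B1Eq324BenfattoLemma.Site d → ℝ)
    (hbox : ∀ m ∈ B, ∀ ξ : B1Eq324BenfattoLemma.Site d → ℝ, ξ ∈ smallFieldOn (corridors L w B : Set (B1Eq324BenfattoLemma.Site d)) (I.image fun x => x + τ) (γ * b) →
      Real.exp (ℓ m) * ∫ z, (smallFieldOn (frame1 L w m : Set (B1Eq324BenfattoLemma.Site d)) (I.image fun x => x + τ) (γ * b)).indicator (fun _ => (1 : ℝ)) z *
              (smallFieldOn (shrink L m w : Set (B1Eq324BenfattoLemma.Site d)) (I.image fun x => x + τ) b).indicator (fun _ => (1 : ℝ)) z *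
              Real.exp (psi1p s D κ (shiftCoef a (-τ)) L w v m z + psi2 s D κ (shiftCoef a (-τ)) L w m z)
            ∂((gaussianFieldOfKernel (Kb m)).map fun (ζ : B1Eq324BenfattoLemma.Site d → ℝ) (x : B1Eq324BenfattoLemma.Site d) => condMean (fun x y => K (x + σ) (y + σ)) (corridors L w B) ξ x + ζ x)
        ≤ ∫ z, (smallFieldOn (frame1 L w m : Set (B1Eq324BenfattoLemma.Site d)) (I.image fun x => x + τ) (γ * b)).indicator (fun _ => (1 : ℝ)) z *
              (smallFieldOn (shrink L m w : Set (B1Eq324BenfattoLemma.Site d)) (I.image fun x => x + τ) b).indicator (fun _ => (1 : ℝ)) z *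
              Real.exp (psiBox s D κ (shiftCoef a (-τ)) L w m z)
            ∂((gaussianFieldOfKernel (Kb m)).map fun (ζ : B1Eq324BenfattoLemma.Site d → ℝ) (x : B1Eq324BenfattoLemma.Site d) => condMean (fun x y => K (x + σ) (y + σ)) (corridors L w B) ξ x + ζ x)) :
    Real.exp (-(s1Const s D d κ * Ac * b ^ D * Real.exp (-(κ / 4 * w)) * J.card)
        - s1Const s D d κ * Ac * b ^ D *
          (Real.exp (-(κ / 4 * w)) * (corridorsBar L w v B).card + Real.exp (-(κ / 4 * v)) * (B.card * (L : ℝ) ^ d))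
        - 2 * ((∑ y : ↥((Λ.image fun y => y - σ) \ corridors L w B),
            Jc / (Real.cosh (θ * max (w : ℝ) (distToRegion (B.biUnion (box L)) y)) - 1)) / (γA - Jc / (Real.cosh (θ * w) - 1)) +
          ((1 + V * M / (γA - Jc) * γ) ^ 2 * b ^ 2 *
          ∑ y : ↥((Λ.image fun y => y - σ) \ corridors L w B),
            Jc / (Real.cosh (θ * max (w : ℝ) (distToRegion (B.biUnion (box L)) y)) - 1) * (1 + distToRegion (I.image fun x => x + τ) y) ^ 2) / 2)
        + ∑ m ∈ B, ℓ m) *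
        ∫ z, cutoffBoltzmann (hamiltonian s D κ (restrictCoef (shiftCoef a (-τ)) (corridorsBar L w v B))
          ((J.image fun x => x + τ) ∩ corridorsBar L w v B)) (I.image fun x => x + τ) (γ * b) z
          ∂gaussianFieldOfKernel (fun x y => K (x + σ) (y + σ))
      ≤ ∫ z, cutoffBoltzmann (hamiltonian s D κ a J) I b z ∂gaussianFieldOfKernel (fun x y => K (x + (τ + σ)) (y + (τ + σ))) := by
  classical
  -- the class member in frame `σ`
  have hKσ := kernel_translate σ hK
  have hAsσ := submatrix_translate_symm σ hAs
  have hγAσ := submatrix_translate_coercive σ hγA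
  have hl2 : ∀ x y : B1Eq324BenfattoLemma.Site d, Real.sqrt (∑ j, ((((x + σ) j : ℝ) - ((y + σ) j : ℝ))) ^ 2) = Real.sqrt (∑ j, (((x j : ℝ) - (y j : ℝ))) ^ 2) :=
    fun x y => l2_translate x y σ
  have hJcσ := submatrix_translate_row_le σ (A := A)
    (fun x y : B1Eq324BenfattoLemma.Site d => Real.cosh (θ * Real.sqrt (∑ j, (((x j : ℝ) - (y j : ℝ))) ^ 2)) - 1) (fun x y => by simp only [hl2]) hJc
  have hMσ := submatrix_translate_row_le σ (A := A)
    (fun x y : B1Eq324BenfattoLemma.Site d => 1 + Real.sqrt (∑ j, (((x j : ℝ) - (y j : ℝ))) ^ 2)) (fun x y => by simp only [hl2]) hM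
  have hVσ := translate_row_le σ (Λ := Λ)
    (fun x y : B1Eq324BenfattoLemma.Site d => Real.exp (-(θ * Real.sqrt (∑ j, (((x j : ℝ) - (y j : ℝ))) ^ 2))) *
      (1 + Real.sqrt (∑ j, (((x j : ℝ) - (y j : ℝ))) ^ 2))) (fun x y => by simp only [hl2]) hV
  -- the labelling and the far kernel
  obtain ⟨π, hπ⟩ := exists_labels (Λ := Λ.image fun y => y - σ) (w := w) hL B
  -- the step in frame `σ`
  have hstep := pavementStep_of_classRows hKσ hAsσ hγA0 hγAσ hθ hJcσ hJcγ hVσ hMσ hκ (coefSupportedIn_frame hJ τ) hAc0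
    (fun p _ Δ _ n _ => abs_shiftCoef_neg_le hAc τ p Δ n) (Finset.image_subset_image hJI) hL hw hv hγ0 hγ1 hb hΓΛ hBΛ hB hguard π hπ
    hKb (fun _ _ => rfl) ℓ hbox
  have hcard : ((J.image fun x => x + τ).card : ℝ) = J.card := by
    rw [Finset.card_image_of_injective _ (add_left_injective τ)]
  rw [hcard] at hstep
  -- read the right side back in frame `σ + τ`
  have hG : IsPosSemidefKernel (fun x y => K (x + σ) (y + σ)) :=
    isPosSemidefKernel_kernel hKσ (posDef_of_coercive hAsσ hγA0 hγAσ)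
  have hframe : ∫ z, cutoffBoltzmann (hamiltonian s D κ a J) I b z ∂gaussianFieldOfKernel (fun x y => K (x + τ + σ) (y + τ + σ)) =
      ∫ z, cutoffBoltzmann (hamiltonian s D κ (shiftCoef a (-τ)) (J.image fun x => x + τ)) (I.image fun x => x + τ) b z
        ∂gaussianFieldOfKernel (fun x y => K (x + σ) (y + σ)) :=
    integral_cutoffBoltzmann_frame (G := fun x y => K (x + σ) (y + σ)) hG J I b τ
  have hKeq : (fun x y : B1Eq324BenfattoLemma.Site d => K (x + (τ + σ)) (y + (τ + σ))) = fun x y => K (x + τ + σ) (y + τ + σ) := by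
    funext x y
    rw [add_assoc, add_assoc]
  rw [hKeq, hframe]
  exact hstep

end Step

/-! ## §3  The lower chain for the class: `n` displaced steps in drifting frames -/

section LowerChain

variable {Λ : Finset (B1Eq324BenfattoLemma.Site d)} {A : Matrix Λ Λ ℝ}
  {K : B1Eq324BenfattoLemma.Site d → B1Eq324BenfattoLemma.Site d → ℝ}
  (hK : ∀ x y, K x y = if h : x ∈ Λ ∧ y ∈ Λ then (A⁻¹ : Matrix Λ Λ ℝ) ⟨x, h.1⟩ ⟨y, h.2⟩ else 0)
  {s D : ℕ} {κ : ℝ} {L w v : ℕ} {γ Ac : ℝ}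

include hK

/-- **THE LOWER CHAIN FOR THE CLASS — `n` DISPLACED PAVEMENT STEPS IN DRIFTING FRAMES** (the class twin of `…Sect5PavementChain.lowerPavementChain`).
For the frame-0 class constants of `(Λ, A)` (`γ_A`, Euclidean Combes–Thomas row `J_c < γ_A` at rate `θ > 0`, growth rows `V`, `M`, guard
`J_c/(cosh θw − 1) < γ_A`), and ANY sequences `J_k ⊆ I_k`, `B_k`, `A_k`, `b_k`, displacements `τ_k` and kernel offsets `σ_k` obeying
`J_{k+1} = (J_k + τ_k) ∩ Γ̄₁(B_k)`, `I_{k+1} = I_k + τ_k`, `A_{k+1} = (A_k(·−τ_k))|_{Γ̄₁(B_k)}`, `b_{k+1} = γb_k`, `σ_0 = 0`, `σ_{k+1} = σ_k − τ_k` (hypotheses — a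
consumer defines the sequences by recursion and discharges them by `rfl`), with `A_0` supported in `J_0` and globally bounded by `A_c ≥ 0`, `B_k ⊇` the
tesserae meeting `J_k + τ_k`, `1 ≤ b_k`, the step-`k` pavement inside the frame-`σ_{k+1}` region `Λ − σ_{k+1}`, the definitional part-kernel rows and
per-box LOWER bounds `ℓ_k(□)` in part-field currency at every step (the translated datum in standard position, conditional means of the frame kernel
`K(·+σ_{k+1},·+σ_{k+1})`):
`exp(Σ_{k<n}(−err₅₁₁(k) − err₅₃₄(k) − 2P_k + Σ_{□∈B_k}ℓ_k(□)))·∫Π_Δχ̂^{I_n}_{b_n}e^{H^{A_n}_{J_n}}dμ_{K(·+σ_n,·+σ_n)} ≤ ∫Π_Δχ̂^{I_0}_{b_0}e^{H^{A_0}_{J_0}}dμ_K`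
with the SAME closed-form price `P_k = ρ_k + T_k/2` at every step (`pavementStep_of_classRows_frame` chained by `…Sect5Termination.exp_sum_mul_le_of_steps`,
the invariants by `…Sect5PavementChain.chain_invariants`). [cite: BenfattoEtAl1978, §5 p.154, (5.35) p.159 «Collecting all the errors made in this process»;
Balaban1985BackgroundPropagators, (1.16)–(1.18) p.180 (class form; ours)] -/
theorem lowerPavementChain
    (hAs : ∀ e e', A e e' = A e' e) {γA : ℝ} (hγA0 : 0 < γA)
    (hγA : ∀ x : Λ → ℝ, γA * ∑ e, x e ^ 2 ≤ ∑ e, ∑ e', A e e' * x e * x e')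
    {θ Jc V M : ℝ} (hθ : 0 < θ)
    (hJc : ∀ e : Λ, ∑ e' : Λ, |A e e'| * (Real.cosh (θ * Real.sqrt (∑ j, ((((e : B1Eq324BenfattoLemma.Site d) j : ℝ) - ((e' : B1Eq324BenfattoLemma.Site d) j : ℝ))) ^ 2)) - 1) ≤ Jc)
    (hJcγ : Jc < γA)
    (hV : ∀ e : Λ, ∑ e' : Λ, Real.exp (-(θ * Real.sqrt (∑ j, ((((e : B1Eq324BenfattoLemma.Site d) j : ℝ) - ((e' : B1Eq324BenfattoLemma.Site d) j : ℝ))) ^ 2))) *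
      (1 + Real.sqrt (∑ j, ((((e : B1Eq324BenfattoLemma.Site d) j : ℝ) - ((e' : B1Eq324BenfattoLemma.Site d) j : ℝ))) ^ 2)) ≤ V)
    (hM : ∀ e : Λ, ∑ e' : Λ, |A e e'| * (1 + Real.sqrt (∑ j, ((((e : B1Eq324BenfattoLemma.Site d) j : ℝ) - ((e' : B1Eq324BenfattoLemma.Site d) j : ℝ))) ^ 2)) ≤ M)
    (hguard : Jc / (Real.cosh (θ * w) - 1) < γA)
    (hκ : 0 < κ) (hL : 0 < L) (hw : 0 < w) (hv : v ≤ w) (hγ0 : 0 ≤ γ) (hγ1 : γ ≤ 1) (hAc0 : 0 ≤ Ac) {n : ℕ}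
    {Js Is Bs : ℕ → Finset (B1Eq324BenfattoLemma.Site d)} {as : ℕ → Coef d} {bs : ℕ → ℝ} {τ σ : ℕ → B1Eq324BenfattoLemma.Site d}
    (hsupp : CoefSupportedIn (as 0) (Js 0))
    (hA : ∀ (p : ℕ) (Δ : Fin p → B1Eq324BenfattoLemma.Site d) (nn : Fin p → ℕ), |as 0 p Δ nn| ≤ Ac) (hJI : Js 0 ⊆ Is 0)
    (hrecJ : ∀ k < n, Js (k + 1) = (Js k).image (fun x => x + τ k) ∩ corridorsBar L w v (Bs k))
    (hrecI : ∀ k < n, Is (k + 1) = (Is k).image fun x => x + τ k)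
    (hreca : ∀ k < n, as (k + 1) = restrictCoef (shiftCoef (as k) (-τ k)) (corridorsBar L w v (Bs k)))
    (hrecb : ∀ k < n, bs (k + 1) = γ * bs k) (hb : ∀ k < n, 1 ≤ bs k)
    (hσ0 : σ 0 = 0) (hrecσ : ∀ k < n, σ (k + 1) = σ k - τ k)
    (hB : ∀ k < n, ((Js k).image fun x => x + τ k).image (boxIndex L) ⊆ Bs k)
    (hΓΛ : ∀ k < n, corridors L w (Bs k) ⊆ Λ.image fun y => y - σ (k + 1))
    (hBΛ : ∀ k, k < n → ∀ m ∈ Bs k, box L m ⊆ Λ.image fun y => y - σ (k + 1))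
    {Kbs : ℕ → B1Eq324BenfattoLemma.Site d → B1Eq324BenfattoLemma.Site d → B1Eq324BenfattoLemma.Site d → ℝ}
    (hKbs : ∀ k (hk : k < n) m (hm : m ∈ Bs k) x y, Kbs k m x y = if h : x ∈ shrink L m w ∧ y ∈ shrink L m w then
      (((A.submatrix (fun j : ↥(Λ.image fun y => y - σ (k + 1)) => (⟨(j : B1Eq324BenfattoLemma.Site d) + σ (k + 1), (mem_image_sub_iff (σ (k + 1))).mp j.2⟩ : Λ))
          (fun j : ↥(Λ.image fun y => y - σ (k + 1)) => (⟨(j : B1Eq324BenfattoLemma.Site d) + σ (k + 1), (mem_image_sub_iff (σ (k + 1))).mp j.2⟩ : Λ))).submatrix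
          (fun j : ↥(shrink L m w) => (⟨j, hBΛ k hk m hm (shrink_subset_box L m w j.2)⟩ : ↥(Λ.image fun y => y - σ (k + 1))))
          (fun j : ↥(shrink L m w) => (⟨j, hBΛ k hk m hm (shrink_subset_box L m w j.2)⟩ : ↥(Λ.image fun y => y - σ (k + 1)))))⁻¹ :
          Matrix ↥(shrink L m w) ↥(shrink L m w) ℝ) ⟨x, h.1⟩ ⟨y, h.2⟩ else 0)
    (ℓ : ℕ → B1Eq324BenfattoLemma.Site d → ℝ)
    (hbox : ∀ k < n, ∀ m ∈ Bs k, ∀ ξ : B1Eq324BenfattoLemma.Site d → ℝ,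
      ξ ∈ smallFieldOn (corridors L w (Bs k) : Set (B1Eq324BenfattoLemma.Site d)) ((Is k).image fun x => x + τ k) (γ * bs k) →
      Real.exp (ℓ k m) * ∫ z, (smallFieldOn (frame1 L w m : Set (B1Eq324BenfattoLemma.Site d)) ((Is k).image fun x => x + τ k) (γ * bs k)).indicator (fun _ => (1 : ℝ)) z *
              (smallFieldOn (shrink L m w : Set (B1Eq324BenfattoLemma.Site d)) ((Is k).image fun x => x + τ k) (bs k)).indicator (fun _ => (1 : ℝ)) z *
              Real.exp (psi1p s D κ (shiftCoef (as k) (-τ k)) L w v m z + psi2 s D κ (shiftCoef (as k) (-τ k)) L w m z)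
            ∂((gaussianFieldOfKernel (Kbs k m)).map fun (ζ : B1Eq324BenfattoLemma.Site d → ℝ) (x : B1Eq324BenfattoLemma.Site d) =>
              condMean (fun x y => K (x + σ (k + 1)) (y + σ (k + 1))) (corridors L w (Bs k)) ξ x + ζ x)
        ≤ ∫ z, (smallFieldOn (frame1 L w m : Set (B1Eq324BenfattoLemma.Site d)) ((Is k).image fun x => x + τ k) (γ * bs k)).indicator (fun _ => (1 : ℝ)) z *
              (smallFieldOn (shrink L m w : Set (B1Eq324BenfattoLemma.Site d)) ((Is k).image fun x => x + τ k) (bs k)).indicator (fun _ => (1 : ℝ)) z *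
              Real.exp (psiBox s D κ (shiftCoef (as k) (-τ k)) L w m z)
            ∂((gaussianFieldOfKernel (Kbs k m)).map fun (ζ : B1Eq324BenfattoLemma.Site d → ℝ) (x : B1Eq324BenfattoLemma.Site d) =>
              condMean (fun x y => K (x + σ (k + 1)) (y + σ (k + 1))) (corridors L w (Bs k)) ξ x + ζ x)) :
    Real.exp (∑ k ∈ Finset.range n,
        (-(s1Const s D d κ * Ac * bs k ^ D * Real.exp (-(κ / 4 * w)) * (Js k).card)
          - s1Const s D d κ * Ac * bs k ^ D *
            (Real.exp (-(κ / 4 * w)) * (corridorsBar L w v (Bs k)).card + Real.exp (-(κ / 4 * v)) * ((Bs k).card * (L : ℝ) ^ d))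
          - 2 * ((∑ y : ↥((Λ.image fun y => y - σ (k + 1)) \ corridors L w (Bs k)),
              Jc / (Real.cosh (θ * max (w : ℝ) (distToRegion ((Bs k).biUnion (box L)) y)) - 1)) / (γA - Jc / (Real.cosh (θ * w) - 1)) +
            ((1 + V * M / (γA - Jc) * γ) ^ 2 * bs k ^ 2 *
            ∑ y : ↥((Λ.image fun y => y - σ (k + 1)) \ corridors L w (Bs k)),
              Jc / (Real.cosh (θ * max (w : ℝ) (distToRegion ((Bs k).biUnion (box L)) y)) - 1) *
                (1 + distToRegion ((Is k).image fun x => x + τ k) y) ^ 2) / 2)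
          + ∑ m ∈ Bs k, ℓ k m)) *
        ∫ z, cutoffBoltzmann (hamiltonian s D κ (as n) (Js n)) (Is n) (bs n) z ∂gaussianFieldOfKernel (fun x y => K (x + σ n) (y + σ n))
      ≤ ∫ z, cutoffBoltzmann (hamiltonian s D κ (as 0) (Js 0)) (Is 0) (bs 0) z ∂gaussianFieldOfKernel K := by
  classical
  have hinv := chain_invariants hsupp hA hJI hrecJ hrecI hreca (n := n)
  have hchain := exp_sum_mul_le_of_steps
    (fun k => ∫ z, cutoffBoltzmann (hamiltonian s D κ (as k) (Js k)) (Is k) (bs k) z ∂gaussianFieldOfKernel (fun x y => K (x + σ k) (y + σ k)))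
    (fun k => (-(s1Const s D d κ * Ac * bs k ^ D * Real.exp (-(κ / 4 * w)) * (Js k).card)
          - s1Const s D d κ * Ac * bs k ^ D *
            (Real.exp (-(κ / 4 * w)) * (corridorsBar L w v (Bs k)).card + Real.exp (-(κ / 4 * v)) * ((Bs k).card * (L : ℝ) ^ d))
          - 2 * ((∑ y : ↥((Λ.image fun y => y - σ (k + 1)) \ corridors L w (Bs k)),
              Jc / (Real.cosh (θ * max (w : ℝ) (distToRegion ((Bs k).biUnion (box L)) y)) - 1)) / (γA - Jc / (Real.cosh (θ * w) - 1)) +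
            ((1 + V * M / (γA - Jc) * γ) ^ 2 * bs k ^ 2 *
            ∑ y : ↥((Λ.image fun y => y - σ (k + 1)) \ corridors L w (Bs k)),
              Jc / (Real.cosh (θ * max (w : ℝ) (distToRegion ((Bs k).biUnion (box L)) y)) - 1) *
                (1 + distToRegion ((Is k).image fun x => x + τ k) y) ^ 2) / 2)
          + ∑ m ∈ Bs k, ℓ k m)) n (fun k hk => by
      obtain ⟨h1, h2, h3, -⟩ := hinv k hk.le
      have hstep := pavementStep_of_classRows_frame hK hAs hγA0 hγA hθ hJc hJcγ hV hM hguard hκ h1 hAc0 h2 h3 hL hw hv hγ0 hγ1 (hb k hk)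
        (σ (k + 1)) (τ k) (hΓΛ k hk) (hBΛ k hk) (hB k hk) (hKbs k hk) (ℓ k) (hbox k hk) (s := s) (D := D)
      have hσk : σ k = τ k + σ (k + 1) := by
        rw [hrecσ k hk]
        abel
      show _ * ∫ z, cutoffBoltzmann (hamiltonian s D κ (as (k + 1)) (Js (k + 1))) (Is (k + 1)) (bs (k + 1)) z
          ∂gaussianFieldOfKernel (fun x y => K (x + σ (k + 1)) (y + σ (k + 1))) ≤
        ∫ z, cutoffBoltzmann (hamiltonian s D κ (as k) (Js k)) (Is k) (bs k) z ∂gaussianFieldOfKernel (fun x y => K (x + σ k) (y + σ k))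
      rw [hrecJ k hk, hrecI k hk, hreca k hk, hrecb k hk, hσk]
      exact hstep)
  have hZ0 : (fun x y : B1Eq324BenfattoLemma.Site d => K (x + σ 0) (y + σ 0)) = K := by
    funext x y
    rw [hσ0, add_zero, add_zero]
  rw [hZ0] at hchain
  exact hchain

/-- **THE (4.7)-SIDE DRIVER FOR THE CLASS — `d + 1` DISPLACED STEPS DOWN TO THE CLASS APPENDIX A, NO SOCKET**: under the hypotheses of
`lowerPavementChain` with `n = d + 1`, displacements whose cumulative points are suitably separated (`…Sect5PavementChain.chain_eq_empty_of_sep`: then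
`J_{d+1} = ∅`, the free case), `I_0 ≠ ∅`, and the terminal cut-off `b_{d+1}² ≥ 4/γ_A`: the terminal integral is the small-field volume of the frame-`σ_{d+1}`
class field, bounded below by seat n08-w5's class Appendix A (`…KernelSect5Termination.integral_cutoffBoltzmann_empty_ge_of_kernel_translate` with the
diagonal bound `K_{xx} ≤ 1/γ_A` of `kernel_self_le_inv`), so
`exp(Σ_{k≤d}(−err₅₁₁(k) − err₅₃₄(k) − 2P_k + Σ_{□∈B_k}ℓ_k(□)) − |I_0|·4·8^d·e^{−γ_A b_{d+1}²/2}) ≤ ∫Π_Δχ̂^{I_0}_{b_0}e^{H^{A_0}_{J_0}}dμ_K` — print's «After (d + 1) steps … we end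
up in the free case … Collecting all the errors made in this process (4.7) is proven», for the whole class, the per-box exponents displayed.
[cite: BenfattoEtAl1978, §5 p.154, p.159; Appendix A (A.1)–(A.2) p.161; Balaban1985BackgroundPropagators, (1.16)–(1.18) p.180 (class form; ours)] -/
theorem lowerPavementChain_appendixA
    (hAs : ∀ e e', A e e' = A e' e) {γA : ℝ} (hγA0 : 0 < γA)
    (hγA : ∀ x : Λ → ℝ, γA * ∑ e, x e ^ 2 ≤ ∑ e, ∑ e', A e e' * x e * x e')
    {θ Jc V M : ℝ} (hθ : 0 < θ)
    (hJc : ∀ e : Λ, ∑ e' : Λ, |A e e'| * (Real.cosh (θ * Real.sqrt (∑ j, ((((e : B1Eq324BenfattoLemma.Site d) j : ℝ) - ((e' : B1Eq324BenfattoLemma.Site d) j : ℝ))) ^ 2)) - 1) ≤ Jc)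
    (hJcγ : Jc < γA)
    (hV : ∀ e : Λ, ∑ e' : Λ, Real.exp (-(θ * Real.sqrt (∑ j, ((((e : B1Eq324BenfattoLemma.Site d) j : ℝ) - ((e' : B1Eq324BenfattoLemma.Site d) j : ℝ))) ^ 2))) *
      (1 + Real.sqrt (∑ j, ((((e : B1Eq324BenfattoLemma.Site d) j : ℝ) - ((e' : B1Eq324BenfattoLemma.Site d) j : ℝ))) ^ 2)) ≤ V)
    (hM : ∀ e : Λ, ∑ e' : Λ, |A e e'| * (1 + Real.sqrt (∑ j, ((((e : B1Eq324BenfattoLemma.Site d) j : ℝ) - ((e' : B1Eq324BenfattoLemma.Site d) j : ℝ))) ^ 2)) ≤ M)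
    (hguard : Jc / (Real.cosh (θ * w) - 1) < γA)
    (hκ : 0 < κ) (hL : 0 < L) (hw : 0 < w) (hv : v ≤ w) (hγ0 : 0 ≤ γ) (hγ1 : γ ≤ 1) (hAc0 : 0 ≤ Ac)
    {Js Is Bs : ℕ → Finset (B1Eq324BenfattoLemma.Site d)} {as : ℕ → Coef d} {bs : ℕ → ℝ} {τ σ : ℕ → B1Eq324BenfattoLemma.Site d}
    (hsupp : CoefSupportedIn (as 0) (Js 0))
    (hA : ∀ (p : ℕ) (Δ : Fin p → B1Eq324BenfattoLemma.Site d) (nn : Fin p → ℕ), |as 0 p Δ nn| ≤ Ac) (hJI : Js 0 ⊆ Is 0)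
    (hrecJ : ∀ k < d + 1, Js (k + 1) = (Js k).image (fun x => x + τ k) ∩ corridorsBar L w v (Bs k))
    (hrecI : ∀ k < d + 1, Is (k + 1) = (Is k).image fun x => x + τ k)
    (hreca : ∀ k < d + 1, as (k + 1) = restrictCoef (shiftCoef (as k) (-τ k)) (corridorsBar L w v (Bs k)))
    (hrecb : ∀ k < d + 1, bs (k + 1) = γ * bs k) (hb : ∀ k < d + 1, 1 ≤ bs k)
    (hσ0 : σ 0 = 0) (hrecσ : ∀ k < d + 1, σ (k + 1) = σ k - τ k)
    (hB : ∀ k < d + 1, ((Js k).image fun x => x + τ k).image (boxIndex L) ⊆ Bs k)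
    (hΓΛ : ∀ k < d + 1, corridors L w (Bs k) ⊆ Λ.image fun y => y - σ (k + 1))
    (hBΛ : ∀ k, k < d + 1 → ∀ m ∈ Bs k, box L m ⊆ Λ.image fun y => y - σ (k + 1))
    {Kbs : ℕ → B1Eq324BenfattoLemma.Site d → B1Eq324BenfattoLemma.Site d → B1Eq324BenfattoLemma.Site d → ℝ}
    (hKbs : ∀ k (hk : k < d + 1) m (hm : m ∈ Bs k) x y, Kbs k m x y = if h : x ∈ shrink L m w ∧ y ∈ shrink L m w then
      (((A.submatrix (fun j : ↥(Λ.image fun y => y - σ (k + 1)) => (⟨(j : B1Eq324BenfattoLemma.Site d) + σ (k + 1), (mem_image_sub_iff (σ (k + 1))).mp j.2⟩ : Λ))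
          (fun j : ↥(Λ.image fun y => y - σ (k + 1)) => (⟨(j : B1Eq324BenfattoLemma.Site d) + σ (k + 1), (mem_image_sub_iff (σ (k + 1))).mp j.2⟩ : Λ))).submatrix
          (fun j : ↥(shrink L m w) => (⟨j, hBΛ k hk m hm (shrink_subset_box L m w j.2)⟩ : ↥(Λ.image fun y => y - σ (k + 1))))
          (fun j : ↥(shrink L m w) => (⟨j, hBΛ k hk m hm (shrink_subset_box L m w j.2)⟩ : ↥(Λ.image fun y => y - σ (k + 1)))))⁻¹ :
          Matrix ↥(shrink L m w) ↥(shrink L m w) ℝ) ⟨x, h.1⟩ ⟨y, h.2⟩ else 0)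
    (ℓ : ℕ → B1Eq324BenfattoLemma.Site d → ℝ)
    (hbox : ∀ k < d + 1, ∀ m ∈ Bs k, ∀ ξ : B1Eq324BenfattoLemma.Site d → ℝ,
      ξ ∈ smallFieldOn (corridors L w (Bs k) : Set (B1Eq324BenfattoLemma.Site d)) ((Is k).image fun x => x + τ k) (γ * bs k) →
      Real.exp (ℓ k m) * ∫ z, (smallFieldOn (frame1 L w m : Set (B1Eq324BenfattoLemma.Site d)) ((Is k).image fun x => x + τ k) (γ * bs k)).indicator (fun _ => (1 : ℝ)) z *
              (smallFieldOn (shrink L m w : Set (B1Eq324BenfattoLemma.Site d)) ((Is k).image fun x => x + τ k) (bs k)).indicator (fun _ => (1 : ℝ)) z *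
              Real.exp (psi1p s D κ (shiftCoef (as k) (-τ k)) L w v m z + psi2 s D κ (shiftCoef (as k) (-τ k)) L w m z)
            ∂((gaussianFieldOfKernel (Kbs k m)).map fun (ζ : B1Eq324BenfattoLemma.Site d → ℝ) (x : B1Eq324BenfattoLemma.Site d) =>
              condMean (fun x y => K (x + σ (k + 1)) (y + σ (k + 1))) (corridors L w (Bs k)) ξ x + ζ x)
        ≤ ∫ z, (smallFieldOn (frame1 L w m : Set (B1Eq324BenfattoLemma.Site d)) ((Is k).image fun x => x + τ k) (γ * bs k)).indicator (fun _ => (1 : ℝ)) z *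
              (smallFieldOn (shrink L m w : Set (B1Eq324BenfattoLemma.Site d)) ((Is k).image fun x => x + τ k) (bs k)).indicator (fun _ => (1 : ℝ)) z *
              Real.exp (psiBox s D κ (shiftCoef (as k) (-τ k)) L w m z)
            ∂((gaussianFieldOfKernel (Kbs k m)).map fun (ζ : B1Eq324BenfattoLemma.Site d → ℝ) (x : B1Eq324BenfattoLemma.Site d) =>
              condMean (fun x y => K (x + σ (k + 1)) (y + σ (k + 1))) (corridors L w (Bs k)) ξ x + ζ x))
    (hsep : ∀ j j' : Fin (d + 1), j ≠ j' → ∀ (i : Fin d) (q : ℤ),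
      (2 * (2 * w + v : ℕ) : ℤ) ≤ |(-(∑ i' ∈ Finset.range ((j : ℕ) + 1), τ i')) i - (-(∑ i' ∈ Finset.range ((j' : ℕ) + 1), τ i')) i - q * L|)
    (hI0 : (Is 0).Nonempty) (hbterm : 4 * (1 / γA) ≤ bs (d + 1) ^ 2) :
    Real.exp (∑ k ∈ Finset.range (d + 1),
        (-(s1Const s D d κ * Ac * bs k ^ D * Real.exp (-(κ / 4 * w)) * (Js k).card)
          - s1Const s D d κ * Ac * bs k ^ D *
            (Real.exp (-(κ / 4 * w)) * (corridorsBar L w v (Bs k)).card + Real.exp (-(κ / 4 * v)) * ((Bs k).card * (L : ℝ) ^ d))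
          - 2 * ((∑ y : ↥((Λ.image fun y => y - σ (k + 1)) \ corridors L w (Bs k)),
              Jc / (Real.cosh (θ * max (w : ℝ) (distToRegion ((Bs k).biUnion (box L)) y)) - 1)) / (γA - Jc / (Real.cosh (θ * w) - 1)) +
            ((1 + V * M / (γA - Jc) * γ) ^ 2 * bs k ^ 2 *
            ∑ y : ↥((Λ.image fun y => y - σ (k + 1)) \ corridors L w (Bs k)),
              Jc / (Real.cosh (θ * max (w : ℝ) (distToRegion ((Bs k).biUnion (box L)) y)) - 1) *
                (1 + distToRegion ((Is k).image fun x => x + τ k) y) ^ 2) / 2)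
          + ∑ m ∈ Bs k, ℓ k m)
        - (Is 0).card * (4 * 8 ^ d * Real.exp (-(bs (d + 1) ^ 2 / (2 * (1 / γA)))))) ≤
      ∫ z, cutoffBoltzmann (hamiltonian s D κ (as 0) (Js 0)) (Is 0) (bs 0) z ∂gaussianFieldOfKernel K := by
  classical
  have hchain := lowerPavementChain hK hAs hγA0 hγA hθ hJc hJcγ hV hM hguard hκ hL hw hv hγ0 hγ1 hAc0 hsupp hA hJI hrecJ hrecI hreca hrecb hb
    hσ0 hrecσ hB hΓΛ hBΛ hKbs ℓ hbox (s := s) (D := D)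
  have hinv := chain_invariants hsupp hA hJI hrecJ hrecI hreca (d + 1) le_rfl
  have hJe : Js (d + 1) = ∅ := chain_eq_empty_of_sep hL hrecJ hsep
  have hIne : (Is (d + 1)).Nonempty := by
    rw [← Finset.card_pos, hinv.2.2.2]
    exact Finset.card_pos.mpr hI0
  -- the terminal cut-off is positive: `b_{d+1} = γ b_d ≥ 0` and `b_{d+1}² ≥ 4/γ_A > 0`
  have hbpos : 0 < bs (d + 1) := by
    have hnn : 0 ≤ bs (d + 1) := by
      rw [hrecb d (Nat.lt_succ_self d)]
      exact mul_nonneg hγ0 (zero_le_one.trans (hb d (Nat.lt_succ_self d)))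
    rcases hnn.lt_or_eq with h | h
    · exact h
    · exfalso
      have : (0 : ℝ) < bs (d + 1) ^ 2 := lt_of_lt_of_le (by positivity) hbterm
      rw [← h] at this
      simp at this
  have hterm : Real.exp (-(((Is 0).card : ℝ) * (4 * 8 ^ d * Real.exp (-(bs (d + 1) ^ 2 / (2 * (1 / γA))))))) ≤
      ∫ z, cutoffBoltzmann (hamiltonian s D κ (as (d + 1)) (Js (d + 1))) (Is (d + 1)) (bs (d + 1)) z
        ∂gaussianFieldOfKernel (fun x y => K (x + σ (d + 1)) (y + σ (d + 1))) := by
    rw [hJe, ← hinv.2.2.2]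
    exact integral_cutoffBoltzmann_empty_ge_of_kernel_translate (isPosSemidefKernel_kernel hK (posDef_of_coercive hAs hγA0 hγA))
      (one_div_pos.mpr hγA0) (kernel_self_le_inv hK hAs hγA0 hγA) hbpos hbterm (as (d + 1)) hIne (σ (d + 1))
  rw [sub_eq_add_neg, Real.exp_add]
  exact (mul_le_mul_of_nonneg_left hterm (Real.exp_pos _).le).trans hchain

end LowerChain

/-! ## §5 (v1.1, APPEND-ONLY)  The (4.7)-side driver AT THE STOPPING INDEX

`lowerPavementChain_appendixA` (§4) runs the fixed `d + 1` separated steps of print.  A class consumer pays the closed-form price `2P_k` at every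
step, and `P_k` is read off the cross rows `r_y = J_c/(cosh(θ·max(w, d(y, ⋃_{□∈B_k}□))) − 1)`: at a step with an EMPTY pavement `B_k = ∅` the distance
to the empty region is the junk value `0` (`…B1Eq324BenfattoLemma.distToRegion`), so `r_y = J_c/(cosh θw − 1)` at every site of the frame region and
`2P_k` is `|Λ|`-extensive (seat n08-b's located point, bus 2026-08-28 09:28Z; every landed price majorant — `…ClassCrossRowMass`,
`…ClassCrossRowMassMoment`, `…KernelSect5LedgerPrice` — carries `B ≠ ∅`).  The displacements empty `J_k` as soon as the shifted points fall into the
corridors, typically before step `d + 1`; print's chain is free of charge at such steps, the class chain is not.  The remedy is to STOP AT THE FIRST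
EMPTY INDEX: the theorem below is §4's driver for `n` steps with the hypothesis `J_n = ∅` in place of the separation of the displacements (a consumer
takes `n :=` the first index with `J_n = ∅`, which exists and is `≤ d + 1` by `…Sect5PavementChain.chain_eq_empty_of_sep`, so that `B_k ≠ ∅` for all
`k < n`), the class Appendix A closing the chain at the terminal cut-off `b_n` (`b_n > 0`, `b_n² ≥ 4/γ_A`). -/

section StoppingIndexExists

variable {L w v : ℕ}

/-- **The stopping index exists**: along the recursion `J_{k+1} = (J_k + τ_k) ∩ Γ̄₁(B_k)` with `d + 1` suitably separated displacements
(`…Sect5PavementChain.chain_eq_empty_of_sep`: `J_{d+1} = ∅`) there is a FIRST index `n ≤ d + 1` with `J_n = ∅`, and `J_k ≠ ∅` for every `k < n` —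
the number of steps a class consumer runs (`lowerPavementChain_appendixA_of_eq_empty` below and `…KernelSect5PavementChainUpper.
upperPavementChainCond_le_exp_of_eq_empty`), so that no step is paid on an empty pavement.  Measure-free.
[cite: BenfattoEtAl1978, §5 p.154 «After (d + 1) steps, (in general less) we end up in the free case»] -/
theorem exists_stoppingIndex (hL : 0 < L) {Js Bs : ℕ → Finset (B1Eq324BenfattoLemma.Site d)} {τ : ℕ → B1Eq324BenfattoLemma.Site d}
    (hrecJ : ∀ k < d + 1, Js (k + 1) = (Js k).image (fun x => x + τ k) ∩ corridorsBar L w v (Bs k))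
    (hsep : ∀ j j' : Fin (d + 1), j ≠ j' → ∀ (i : Fin d) (q : ℤ),
      (2 * (2 * w + v : ℕ) : ℤ) ≤ |(-(∑ i' ∈ Finset.range ((j : ℕ) + 1), τ i')) i - (-(∑ i' ∈ Finset.range ((j' : ℕ) + 1), τ i')) i - q * L|) :
    ∃ n ≤ d + 1, Js n = ∅ ∧ ∀ k < n, (Js k).Nonempty := by
  classical
  have hex : ∃ m, Js m = ∅ := ⟨d + 1, chain_eq_empty_of_sep hL hrecJ hsep⟩
  exact ⟨Nat.find hex, Nat.find_min' hex (chain_eq_empty_of_sep hL hrecJ hsep), Nat.find_spec hex,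
    fun k hk => Finset.nonempty_iff_ne_empty.mpr (Nat.find_min hex hk)⟩

end StoppingIndexExists

section StoppingIndex

variable {Λ : Finset (B1Eq324BenfattoLemma.Site d)} {A : Matrix Λ Λ ℝ}
  {K : B1Eq324BenfattoLemma.Site d → B1Eq324BenfattoLemma.Site d → ℝ}
  (hK : ∀ x y, K x y = if h : x ∈ Λ ∧ y ∈ Λ then (A⁻¹ : Matrix Λ Λ ℝ) ⟨x, h.1⟩ ⟨y, h.2⟩ else 0)
  {s D : ℕ} {κ : ℝ} {L w v : ℕ} {γ Ac : ℝ}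

include hK

/-- **THE (4.7)-SIDE DRIVER FOR THE CLASS AT THE STOPPING INDEX — `n` DISPLACED STEPS ENDING IN THE FREE CASE, NO SOCKET**: under the hypotheses of
`lowerPavementChain` (`n` steps), `J_n = ∅`, `I_0 ≠ ∅`, and a terminal cut-off `b_n > 0` with `b_n² ≥ 4/γ_A`, the terminal integral is the small-field
volume of the frame-`σ_n` class field, bounded below by seat n08-w5's class Appendix A
(`…KernelSect5Termination.integral_cutoffBoltzmann_empty_ge_of_kernel_translate`, diagonal bound `K_{xx} ≤ 1/γ_A` of `kernel_self_le_inv`), so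
`exp(Σ_{k<n}(−err₅₁₁(k) − err₅₃₄(k) − 2P_k + Σ_{□∈B_k}ℓ_k(□)) − |I_0|·4·8^d·e^{−γ_A b_n²/2}) ≤ ∫Π_Δχ̂^{I_0}_{b_0}e^{H^{A_0}_{J_0}}dμ_K` — `lowerPavementChain_appendixA`
with the separation hypothesis `hsep` REPLACED by `J_n = ∅` at a general `n` (print: «After (d + 1) steps, (in general less) we end up in the free
case»; the consumer stops at the first empty index so that no step runs on an empty pavement).
[cite: BenfattoEtAl1978, §5 p.154 «(in general less)», p.159; Appendix A (A.1)–(A.2) p.161; Balaban1985BackgroundPropagators, (1.16)–(1.18) p.180 (class form; ours)] -/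
theorem lowerPavementChain_appendixA_of_eq_empty
    (hAs : ∀ e e', A e e' = A e' e) {γA : ℝ} (hγA0 : 0 < γA)
    (hγA : ∀ x : Λ → ℝ, γA * ∑ e, x e ^ 2 ≤ ∑ e, ∑ e', A e e' * x e * x e')
    {θ Jc V M : ℝ} (hθ : 0 < θ)
    (hJc : ∀ e : Λ, ∑ e' : Λ, |A e e'| * (Real.cosh (θ * Real.sqrt (∑ j, ((((e : B1Eq324BenfattoLemma.Site d) j : ℝ) - ((e' : B1Eq324BenfattoLemma.Site d) j : ℝ))) ^ 2)) - 1) ≤ Jc)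
    (hJcγ : Jc < γA)
    (hV : ∀ e : Λ, ∑ e' : Λ, Real.exp (-(θ * Real.sqrt (∑ j, ((((e : B1Eq324BenfattoLemma.Site d) j : ℝ) - ((e' : B1Eq324BenfattoLemma.Site d) j : ℝ))) ^ 2))) *
      (1 + Real.sqrt (∑ j, ((((e : B1Eq324BenfattoLemma.Site d) j : ℝ) - ((e' : B1Eq324BenfattoLemma.Site d) j : ℝ))) ^ 2)) ≤ V)
    (hM : ∀ e : Λ, ∑ e' : Λ, |A e e'| * (1 + Real.sqrt (∑ j, ((((e : B1Eq324BenfattoLemma.Site d) j : ℝ) - ((e' : B1Eq324BenfattoLemma.Site d) j : ℝ))) ^ 2)) ≤ M)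
    (hguard : Jc / (Real.cosh (θ * w) - 1) < γA)
    (hκ : 0 < κ) (hL : 0 < L) (hw : 0 < w) (hv : v ≤ w) (hγ0 : 0 ≤ γ) (hγ1 : γ ≤ 1) (hAc0 : 0 ≤ Ac) {n : ℕ}
    {Js Is Bs : ℕ → Finset (B1Eq324BenfattoLemma.Site d)} {as : ℕ → Coef d} {bs : ℕ → ℝ} {τ σ : ℕ → B1Eq324BenfattoLemma.Site d}
    (hsupp : CoefSupportedIn (as 0) (Js 0))
    (hA : ∀ (p : ℕ) (Δ : Fin p → B1Eq324BenfattoLemma.Site d) (nn : Fin p → ℕ), |as 0 p Δ nn| ≤ Ac) (hJI : Js 0 ⊆ Is 0)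
    (hrecJ : ∀ k < n, Js (k + 1) = (Js k).image (fun x => x + τ k) ∩ corridorsBar L w v (Bs k))
    (hrecI : ∀ k < n, Is (k + 1) = (Is k).image fun x => x + τ k)
    (hreca : ∀ k < n, as (k + 1) = restrictCoef (shiftCoef (as k) (-τ k)) (corridorsBar L w v (Bs k)))
    (hrecb : ∀ k < n, bs (k + 1) = γ * bs k) (hb : ∀ k < n, 1 ≤ bs k)
    (hσ0 : σ 0 = 0) (hrecσ : ∀ k < n, σ (k + 1) = σ k - τ k)
    (hB : ∀ k < n, ((Js k).image fun x => x + τ k).image (boxIndex L) ⊆ Bs k)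
    (hΓΛ : ∀ k < n, corridors L w (Bs k) ⊆ Λ.image fun y => y - σ (k + 1))
    (hBΛ : ∀ k, k < n → ∀ m ∈ Bs k, box L m ⊆ Λ.image fun y => y - σ (k + 1))
    {Kbs : ℕ → B1Eq324BenfattoLemma.Site d → B1Eq324BenfattoLemma.Site d → B1Eq324BenfattoLemma.Site d → ℝ}
    (hKbs : ∀ k (hk : k < n) m (hm : m ∈ Bs k) x y, Kbs k m x y = if h : x ∈ shrink L m w ∧ y ∈ shrink L m w then
      (((A.submatrix (fun j : ↥(Λ.image fun y => y - σ (k + 1)) => (⟨(j : B1Eq324BenfattoLemma.Site d) + σ (k + 1), (mem_image_sub_iff (σ (k + 1))).mp j.2⟩ : Λ))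
          (fun j : ↥(Λ.image fun y => y - σ (k + 1)) => (⟨(j : B1Eq324BenfattoLemma.Site d) + σ (k + 1), (mem_image_sub_iff (σ (k + 1))).mp j.2⟩ : Λ))).submatrix
          (fun j : ↥(shrink L m w) => (⟨j, hBΛ k hk m hm (shrink_subset_box L m w j.2)⟩ : ↥(Λ.image fun y => y - σ (k + 1))))
          (fun j : ↥(shrink L m w) => (⟨j, hBΛ k hk m hm (shrink_subset_box L m w j.2)⟩ : ↥(Λ.image fun y => y - σ (k + 1)))))⁻¹ :
          Matrix ↥(shrink L m w) ↥(shrink L m w) ℝ) ⟨x, h.1⟩ ⟨y, h.2⟩ else 0)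
    (ℓ : ℕ → B1Eq324BenfattoLemma.Site d → ℝ)
    (hbox : ∀ k < n, ∀ m ∈ Bs k, ∀ ξ : B1Eq324BenfattoLemma.Site d → ℝ,
      ξ ∈ smallFieldOn (corridors L w (Bs k) : Set (B1Eq324BenfattoLemma.Site d)) ((Is k).image fun x => x + τ k) (γ * bs k) →
      Real.exp (ℓ k m) * ∫ z, (smallFieldOn (frame1 L w m : Set (B1Eq324BenfattoLemma.Site d)) ((Is k).image fun x => x + τ k) (γ * bs k)).indicator (fun _ => (1 : ℝ)) z *
              (smallFieldOn (shrink L m w : Set (B1Eq324BenfattoLemma.Site d)) ((Is k).image fun x => x + τ k) (bs k)).indicator (fun _ => (1 : ℝ)) z *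
              Real.exp (psi1p s D κ (shiftCoef (as k) (-τ k)) L w v m z + psi2 s D κ (shiftCoef (as k) (-τ k)) L w m z)
            ∂((gaussianFieldOfKernel (Kbs k m)).map fun (ζ : B1Eq324BenfattoLemma.Site d → ℝ) (x : B1Eq324BenfattoLemma.Site d) =>
              condMean (fun x y => K (x + σ (k + 1)) (y + σ (k + 1))) (corridors L w (Bs k)) ξ x + ζ x)
        ≤ ∫ z, (smallFieldOn (frame1 L w m : Set (B1Eq324BenfattoLemma.Site d)) ((Is k).image fun x => x + τ k) (γ * bs k)).indicator (fun _ => (1 : ℝ)) z *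
              (smallFieldOn (shrink L m w : Set (B1Eq324BenfattoLemma.Site d)) ((Is k).image fun x => x + τ k) (bs k)).indicator (fun _ => (1 : ℝ)) z *
              Real.exp (psiBox s D κ (shiftCoef (as k) (-τ k)) L w m z)
            ∂((gaussianFieldOfKernel (Kbs k m)).map fun (ζ : B1Eq324BenfattoLemma.Site d → ℝ) (x : B1Eq324BenfattoLemma.Site d) =>
              condMean (fun x y => K (x + σ (k + 1)) (y + σ (k + 1))) (corridors L w (Bs k)) ξ x + ζ x))
    (hJn : Js n = ∅) (hI0 : (Is 0).Nonempty) (hbn : 0 < bs n) (hbterm : 4 * (1 / γA) ≤ bs n ^ 2) :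
    Real.exp (∑ k ∈ Finset.range n,
        (-(s1Const s D d κ * Ac * bs k ^ D * Real.exp (-(κ / 4 * w)) * (Js k).card)
          - s1Const s D d κ * Ac * bs k ^ D *
            (Real.exp (-(κ / 4 * w)) * (corridorsBar L w v (Bs k)).card + Real.exp (-(κ / 4 * v)) * ((Bs k).card * (L : ℝ) ^ d))
          - 2 * ((∑ y : ↥((Λ.image fun y => y - σ (k + 1)) \ corridors L w (Bs k)),
              Jc / (Real.cosh (θ * max (w : ℝ) (distToRegion ((Bs k).biUnion (box L)) y)) - 1)) / (γA - Jc / (Real.cosh (θ * w) - 1)) +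
            ((1 + V * M / (γA - Jc) * γ) ^ 2 * bs k ^ 2 *
            ∑ y : ↥((Λ.image fun y => y - σ (k + 1)) \ corridors L w (Bs k)),
              Jc / (Real.cosh (θ * max (w : ℝ) (distToRegion ((Bs k).biUnion (box L)) y)) - 1) *
                (1 + distToRegion ((Is k).image fun x => x + τ k) y) ^ 2) / 2)
          + ∑ m ∈ Bs k, ℓ k m)
        - (Is 0).card * (4 * 8 ^ d * Real.exp (-(bs n ^ 2 / (2 * (1 / γA)))))) ≤
      ∫ z, cutoffBoltzmann (hamiltonian s D κ (as 0) (Js 0)) (Is 0) (bs 0) z ∂gaussianFieldOfKernel K := by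
  classical
  have hchain := lowerPavementChain hK hAs hγA0 hγA hθ hJc hJcγ hV hM hguard hκ hL hw hv hγ0 hγ1 hAc0 hsupp hA hJI hrecJ hrecI hreca hrecb hb
    hσ0 hrecσ hB hΓΛ hBΛ hKbs ℓ hbox (s := s) (D := D)
  have hinv := chain_invariants hsupp hA hJI hrecJ hrecI hreca n le_rfl
  have hIne : (Is n).Nonempty := by
    rw [← Finset.card_pos, hinv.2.2.2]
    exact Finset.card_pos.mpr hI0
  have hterm : Real.exp (-(((Is 0).card : ℝ) * (4 * 8 ^ d * Real.exp (-(bs n ^ 2 / (2 * (1 / γA))))))) ≤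
      ∫ z, cutoffBoltzmann (hamiltonian s D κ (as n) (Js n)) (Is n) (bs n) z
        ∂gaussianFieldOfKernel (fun x y => K (x + σ n) (y + σ n)) := by
    rw [hJn, ← hinv.2.2.2]
    exact integral_cutoffBoltzmann_empty_ge_of_kernel_translate (isPosSemidefKernel_kernel hK (posDef_of_coercive hAs hγA0 hγA))
      (one_div_pos.mpr hγA0) (kernel_self_le_inv hK hAs hγA0 hγA) hbn hbterm (as n) hIne (σ n)
  rw [sub_eq_add_neg, Real.exp_add]
  exact (mul_le_mul_of_nonneg_left hterm (Real.exp_pos _).le).trans hchain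

end StoppingIndex

end Literature.MathematicalPhysics.QuantumFieldTheory.Balaban1983to89.B1Eq324BenfattoKernelSect5PavementChain

end
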